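import Summits.SmoothPoincare4.SmoothPoincare4.Theorems.ConvexBisectionAcyclicBisectionExistsStdSympChain
import HarnessLib

/-!
# Transvections along `e_j`, `f_j`, `e_j − e_k` in coordinates; the Euclidean algorithm on one
# symplectic pair and the two-pair "kill" (wave 6, brick G6-1 of node N3a `node_STcurve` of
# stub `stub_STgeo` = NF4 N3, line `modp-braid-orbits`, crux `ConvexBisection.AcyclicBisectionExists`,
# item stmt-SmoothPoincare4-10508; registered sub-goal `helper_twoPair_transvection_kill`)

Algebra for the corrected route to N3a (every primitive class of `ℤ^{2g} = H₁(F_{g,1}; ℤ)` is the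
shadow of an embedded page curve): the group generated by the transvections
`transvection (stdSymp ℤ g) (a, ±)` (`SignedHurwitzAction.lean`) along the coordinate vectors
`e_j = Pi.single (inl j) 1`, `f_j = Pi.single (inr j) 1` and the differences `e_j − e_k` acts
transitively on primitive vectors.  (The `2g` CHAIN transvections alone — along `chainVec g i`,
i.e. `e_0`, the `f_j` and the `e_j − e_{j-1}` — do NOT, for `g ≥ 2`: they generate the
hyperelliptic = braid-group image, which preserves a quadratic form mod `2`; see the report.)
This file is the coordinate engine, stated for an ARBITRARY reflexive–transitive relation `R` on
`ℤ^{Fin n ⊕ Fin n}` closed under the relevant moves (so that no definition is introduced):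

* §1 the three transvections in coordinates (`transvection_single_inl_apply`: `e_j` adds
  `± x_{f_j}` to the `e_j`-coordinate; `transvection_single_inr_apply`: `f_j` subtracts `± x_{e_j}`
  from the `f_j`-coordinate; `transvection_single_sub_single_apply`: `e_j − e_k` moves
  `±(x_{f_j} − x_{f_k})` from the `e_k`- to the `e_j`-coordinate);
* §2 **the Euclidean algorithm on one pair** (`pair_euclid`): by the moves along `e_j`, `f_j` every
  vector is `R`-related to one with `j`-th pair `(gcd, 0)`, all other coordinates unchanged
  (`SL(2, ℤ) = ⟨[1 1; 0 1], [1 0; -1 1]⟩` acting on `ℤ²`);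
* §3 **the two-pair kill** (`twoPair_kill`, registered `helper_twoPair_transvection_kill`): by the
  moves along `e_j, f_j, e_k, f_k, e_j − e_k` every vector is `R`-related to one whose `j`-th pair
  VANISHES, all coordinates outside the two pairs unchanged — the Euclidean algorithm on the pair
  of gcd's `(γ_j, γ_k)` (`γ_j ↦ γ_j − γ_k` resp. `γ_k ↦ γ_k − γ_j` by one difference move between
  suitably normalised pairs), finished by an explicit eight-move "revive and kill" when `γ_k = 0`.

Everything is proved; no definitions, no named facts, no `sorry`.  Reference: M. Newman,
*Integral Matrices* (1972), Ch. VII (symplectic group over `ℤ`, transitivity on primitive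
vectors) — here re-proved from scratch by the Euclidean algorithm. [folklore]
-/

noncomputable section

set_option linter.dupNamespace false

open Set Function
open Literature.Topology.FourManifolds Literature.Topology.FourManifolds.LefschetzBase
  Literature.GroupTheory.CombinatorialGroupTheory.SignedHurwitz

namespace Summit.SmoothPoincare4.SmoothPoincare4.Theorems.AcyclicBisectionExists.ModpBraidOrbits

variable {n : ℕ}

/-! ## §1 The three kinds of transvections in coordinates -/

/-- **`T_{e_j}^{±}` in coordinates**: it adds `± x_{f_j}` to the `e_j`-coordinate and fixes all
other coordinates (`ω(e_j, x) = x_{f_j}`). [folklore] -/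
theorem transvection_single_inl_apply (j : Fin n) (s : Bool) (x : Fin n ⊕ Fin n → ℤ) :
    transvection (stdSymp ℤ n) (Pi.single (Sum.inl j) 1, s) x =
      Function.update x (Sum.inl j) (x (Sum.inl j) + sgn s * x (Sum.inr j)) := by
  ext k
  simp only [transvection_apply, stdSymp_int_single_inl, Pi.add_apply, Pi.smul_apply, smul_eq_mul]
  by_cases hk : k = Sum.inl j
  · subst hk
    simp
  · rw [Function.update_of_ne hk, Pi.single_eq_of_ne hk, mul_zero, add_zero]

/-- **`T_{f_j}^{±}` in coordinates**: it subtracts `± x_{e_j}` from the `f_j`-coordinate and fixes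
all other coordinates (`ω(f_j, x) = −x_{e_j}`). [folklore] -/
theorem transvection_single_inr_apply (j : Fin n) (s : Bool) (x : Fin n ⊕ Fin n → ℤ) :
    transvection (stdSymp ℤ n) (Pi.single (Sum.inr j) 1, s) x =
      Function.update x (Sum.inr j) (x (Sum.inr j) - sgn s * x (Sum.inl j)) := by
  ext k
  simp only [transvection_apply, stdSymp_int_single_inr, Pi.add_apply, Pi.smul_apply, smul_eq_mul]
  by_cases hk : k = Sum.inr j
  · subst hk
    simp
    ring
  · rw [Function.update_of_ne hk, Pi.single_eq_of_ne hk, mul_zero, add_zero]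

/-- **`T_{e_j − e_k}^{±}` in coordinates** (`j ≠ k`): with `c = ±(x_{f_j} − x_{f_k})` it adds `c`
to the `e_j`-coordinate, subtracts `c` from the `e_k`-coordinate and fixes all other coordinates
(`ω(e_j − e_k, x) = x_{f_j} − x_{f_k}`). [folklore] -/
theorem transvection_single_sub_single_apply {j k : Fin n} (hjk : j ≠ k) (s : Bool)
    (x : Fin n ⊕ Fin n → ℤ) :
    transvection (stdSymp ℤ n) (Pi.single (Sum.inl j) 1 - Pi.single (Sum.inl k) 1, s) x =
      Function.update (Function.update x (Sum.inl j)
        (x (Sum.inl j) + sgn s * (x (Sum.inr j) - x (Sum.inr k))))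
        (Sum.inl k) (x (Sum.inl k) - sgn s * (x (Sum.inr j) - x (Sum.inr k))) := by
  have hkj : (Sum.inl k : Fin n ⊕ Fin n) ≠ Sum.inl j := fun h => hjk (Sum.inl_injective h).symm
  ext l
  simp only [transvection_apply, map_sub, LinearMap.sub_apply, stdSymp_int_single_inl, Pi.add_apply,
    Pi.smul_apply, smul_eq_mul, Pi.sub_apply]
  by_cases hl : l = Sum.inl k
  · subst hl
    rw [Function.update_self, Pi.single_eq_of_ne hkj, Pi.single_eq_same]
    ring
  rw [Function.update_of_ne hl]
  by_cases hl' : l = Sum.inl j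
  · subst hl'
    rw [Function.update_self, Pi.single_eq_same, Pi.single_eq_of_ne (Ne.symm hkj)]
    ring
  · rw [Function.update_of_ne hl', Pi.single_eq_of_ne hl', Pi.single_eq_of_ne hl, sub_zero,
      mul_zero, add_zero]

/-! ## §2 The Euclidean algorithm on one symplectic pair -/

section Pair

variable {R : (Fin n ⊕ Fin n → ℤ) → (Fin n ⊕ Fin n → ℤ) → Prop} (j : Fin n)

/-- One move along `e_j`, read on the pair and off the pair. [folklore] -/
theorem exists_move_inl (hE : ∀ x s, R x (transvection (stdSymp ℤ n) (Pi.single (Sum.inl j) 1, s) x))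
    (x : Fin n ⊕ Fin n → ℤ) (s : Bool) :
    ∃ y, R x y ∧ y (Sum.inl j) = x (Sum.inl j) + sgn s * x (Sum.inr j) ∧ y (Sum.inr j) = x (Sum.inr j) ∧
      ∀ k, k ≠ Sum.inl j → k ≠ Sum.inr j → y k = x k := by
  refine ⟨_, hE x s, ?_, ?_, fun k hk _ => ?_⟩
  · rw [transvection_single_inl_apply, Function.update_self]
  · rw [transvection_single_inl_apply, Function.update_of_ne Sum.inr_ne_inl]
  · rw [transvection_single_inl_apply, Function.update_of_ne hk]

/-- One move along `f_j`, read on the pair and off the pair. [folklore] -/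
theorem exists_move_inr (hF : ∀ x s, R x (transvection (stdSymp ℤ n) (Pi.single (Sum.inr j) 1, s) x))
    (x : Fin n ⊕ Fin n → ℤ) (s : Bool) :
    ∃ y, R x y ∧ y (Sum.inl j) = x (Sum.inl j) ∧ y (Sum.inr j) = x (Sum.inr j) - sgn s * x (Sum.inl j) ∧
      ∀ k, k ≠ Sum.inl j → k ≠ Sum.inr j → y k = x k := by
  refine ⟨_, hF x s, ?_, ?_, fun k _ hk => ?_⟩
  · rw [transvection_single_inr_apply, Function.update_of_ne Sum.inl_ne_inr]
  · rw [transvection_single_inr_apply, Function.update_self]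
  · rw [transvection_single_inr_apply, Function.update_of_ne hk]

variable (hrefl : ∀ x, R x x) (htrans : ∀ x y z, R x y → R y z → R x z)
  (hE : ∀ x s, R x (transvection (stdSymp ℤ n) (Pi.single (Sum.inl j) 1, s) x))
  (hF : ∀ x s, R x (transvection (stdSymp ℤ n) (Pi.single (Sum.inr j) 1, s) x))
include hrefl htrans hE hF

/-- Sign fix: a pair `(P, 0)` is moved to `(|P|, 0)` (four moves when `P < 0`). [folklore] -/
theorem pair_signfix (x : Fin n ⊕ Fin n → ℤ) (hQ : x (Sum.inr j) = 0) :
    ∃ y, R x y ∧ y (Sum.inl j) = |x (Sum.inl j)| ∧ y (Sum.inr j) = 0 ∧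
      ∀ k, k ≠ Sum.inl j → k ≠ Sum.inr j → y k = x k := by
  rcases le_or_gt 0 (x (Sum.inl j)) with hP | hP
  · exact ⟨x, hrefl x, (abs_of_nonneg hP).symm, hQ, fun k _ _ => rfl⟩
  obtain ⟨x₁, h₁, h₁l, h₁r, h₁o⟩ := exists_move_inr j hF x false
  obtain ⟨x₂, h₂, h₂l, h₂r, h₂o⟩ := exists_move_inl j hE x₁ false
  obtain ⟨x₃, h₃, h₃l, h₃r, h₃o⟩ := exists_move_inl j hE x₂ false
  obtain ⟨x₄, h₄, h₄l, h₄r, h₄o⟩ := exists_move_inr j hF x₃ false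
  refine ⟨x₄, htrans _ _ _ (htrans _ _ _ (htrans _ _ _ h₁ h₂) h₃) h₄, ?_, ?_, fun k hk hk' => ?_⟩
  · rw [h₄l, h₃l, h₂l, h₂r, h₁l, h₁r, hQ, sgn_false, abs_of_neg hP]
    ring
  · rw [h₄r, h₃r, h₃l, h₂r, h₂l, h₁r, h₁l, hQ, sgn_false]
    ring
  · rw [h₄o k hk hk', h₃o k hk hk', h₂o k hk hk', h₁o k hk hk']

/-- **The Euclidean algorithm on the `j`-th symplectic pair**: by moves along `e_j` and `f_j`
every vector is `R`-related to the vector with the same coordinates off the pair and `j`-th pair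
`(gcd, 0)`. [folklore] -/
theorem pair_euclid (x : Fin n ⊕ Fin n → ℤ) :
    ∃ y, R x y ∧ y (Sum.inl j) = Int.gcd (x (Sum.inl j)) (x (Sum.inr j)) ∧ y (Sum.inr j) = 0 ∧
      ∀ k, k ≠ Sum.inl j → k ≠ Sum.inr j → y k = x k := by
  suffices H : ∀ (m : ℕ) (x : Fin n ⊕ Fin n → ℤ),
      (x (Sum.inl j)).natAbs + (x (Sum.inr j)).natAbs = m →
      ∃ y, R x y ∧ y (Sum.inl j) = Int.gcd (x (Sum.inl j)) (x (Sum.inr j)) ∧ y (Sum.inr j) = 0 ∧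
        ∀ k, k ≠ Sum.inl j → k ≠ Sum.inr j → y k = x k from H _ x rfl
  intro m
  induction m using Nat.strong_induction_on with
  | _ m ih =>
  intro x hm
  -- the pair `(P, Q)`
  by_cases hQ : x (Sum.inr j) = 0
  · obtain ⟨y, hy, hyl, hyr, hyo⟩ := pair_signfix j hrefl htrans hE hF x hQ
    refine ⟨y, hy, ?_, hyr, hyo⟩
    rw [hyl, hQ, Int.gcd_zero_right, Int.natCast_natAbs]
  by_cases hP : x (Sum.inl j) = 0
  · -- `(0, Q) ↦ (Q, Q) ↦ (Q, 0)`, then the sign fix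
    obtain ⟨x₁, h₁, h₁l, h₁r, h₁o⟩ := exists_move_inl j hE x true
    obtain ⟨x₂, h₂, h₂l, h₂r, h₂o⟩ := exists_move_inr j hF x₁ true
    have h₂r' : x₂ (Sum.inr j) = 0 := by rw [h₂r, h₁r, h₁l, hP, sgn_true]; ring
    have h₂l' : x₂ (Sum.inl j) = x (Sum.inr j) := by rw [h₂l, h₁l, hP, sgn_true]; ring
    obtain ⟨y, hy, hyl, hyr, hyo⟩ := pair_signfix j hrefl htrans hE hF x₂ h₂r'
    refine ⟨y, htrans _ _ _ (htrans _ _ _ h₁ h₂) hy, ?_, hyr, fun k hk hk' => ?_⟩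
    · rw [hyl, h₂l', hP, Int.gcd_zero_left, Int.natCast_natAbs]
    · rw [hyo k hk hk', h₂o k hk hk', h₁o k hk hk']
  -- both non-zero: one subtraction decreases `|P| + |Q|`
  rcases le_or_gt (x (Sum.inr j)).natAbs (x (Sum.inl j)).natAbs with hle | hlt
  · -- `|Q| ≤ |P|`: change `P` by `∓ Q`
    obtain ⟨s, hs⟩ : ∃ s : Bool, (x (Sum.inl j) + sgn s * x (Sum.inr j)).natAbs + (x (Sum.inr j)).natAbs
        < (x (Sum.inl j)).natAbs + (x (Sum.inr j)).natAbs := by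
      rcases lt_or_gt_of_ne hP with hP' | hP' <;> rcases lt_or_gt_of_ne hQ with hQ' | hQ'
      · exact ⟨false, by rw [sgn_false]; omega⟩
      · exact ⟨true, by rw [sgn_true]; omega⟩
      · exact ⟨true, by rw [sgn_true]; omega⟩
      · exact ⟨false, by rw [sgn_false]; omega⟩
    obtain ⟨x₁, h₁, h₁l, h₁r, h₁o⟩ := exists_move_inl j hE x s
    obtain ⟨y, hy, hyl, hyr, hyo⟩ := ih _ (hm ▸ (by rw [h₁l, h₁r]; exact hs)) x₁ rfl
    refine ⟨y, htrans _ _ _ h₁ hy, ?_, hyr, fun k hk hk' => ?_⟩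
    · rw [hyl, h₁l, h₁r, Int.gcd_add_mul_right_left]
    · rw [hyo k hk hk', h₁o k hk hk']
  · -- `|P| < |Q|`: change `Q` by `∓ P`
    obtain ⟨s, hs⟩ : ∃ s : Bool, (x (Sum.inl j)).natAbs + (x (Sum.inr j) - sgn s * x (Sum.inl j)).natAbs
        < (x (Sum.inl j)).natAbs + (x (Sum.inr j)).natAbs := by
      rcases lt_or_gt_of_ne hP with hP' | hP' <;> rcases lt_or_gt_of_ne hQ with hQ' | hQ'
      · exact ⟨true, by rw [sgn_true]; omega⟩
      · exact ⟨false, by rw [sgn_false]; omega⟩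
      · exact ⟨false, by rw [sgn_false]; omega⟩
      · exact ⟨true, by rw [sgn_true]; omega⟩
    obtain ⟨x₁, h₁, h₁l, h₁r, h₁o⟩ := exists_move_inr j hF x s
    obtain ⟨y, hy, hyl, hyr, hyo⟩ := ih _ (hm ▸ (by rw [h₁l, h₁r]; exact hs)) x₁ rfl
    refine ⟨y, htrans _ _ _ h₁ hy, ?_, hyr, fun k hk hk' => ?_⟩
    · rw [hyl, h₁l, h₁r, sub_eq_add_neg, ← neg_mul, Int.gcd_comm, Int.gcd_add_mul_right_left,
        Int.gcd_comm]
    · rw [hyo k hk hk', h₁o k hk hk']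

/-- From the normal form: the pair can be set to `(γ, γ)` (`γ` the gcd). [folklore] -/
theorem pair_euclid_diag (x : Fin n ⊕ Fin n → ℤ) :
    ∃ y, R x y ∧ y (Sum.inl j) = Int.gcd (x (Sum.inl j)) (x (Sum.inr j)) ∧
      y (Sum.inr j) = Int.gcd (x (Sum.inl j)) (x (Sum.inr j)) ∧
      ∀ k, k ≠ Sum.inl j → k ≠ Sum.inr j → y k = x k := by
  obtain ⟨x₁, h₁, h₁l, h₁r, h₁o⟩ := pair_euclid j hrefl htrans hE hF x
  obtain ⟨y, hy, hyl, hyr, hyo⟩ := exists_move_inr j hF x₁ false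
  refine ⟨y, htrans _ _ _ h₁ hy, by rw [hyl, h₁l], ?_, fun k hk hk' => by rw [hyo k hk hk', h₁o k hk hk']⟩
  rw [hyr, h₁r, h₁l, sgn_false]
  ring

/-- From the normal form: the pair can be set to `(0, γ)` (`γ` the gcd). [folklore] -/
theorem pair_euclid_inr (x : Fin n ⊕ Fin n → ℤ) :
    ∃ y, R x y ∧ y (Sum.inl j) = 0 ∧ y (Sum.inr j) = Int.gcd (x (Sum.inl j)) (x (Sum.inr j)) ∧
      ∀ k, k ≠ Sum.inl j → k ≠ Sum.inr j → y k = x k := by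
  obtain ⟨x₁, h₁, h₁l, h₁r, h₁o⟩ := pair_euclid_diag j hrefl htrans hE hF x
  obtain ⟨y, hy, hyl, hyr, hyo⟩ := exists_move_inl j hE x₁ false
  refine ⟨y, htrans _ _ _ h₁ hy, ?_, by rw [hyr, h₁r], fun k hk hk' => by rw [hyo k hk hk', h₁o k hk hk']⟩
  rw [hyl, h₁l, h₁r, sgn_false]
  ring

end Pair

/-! ## §3 The two-pair kill -/

section TwoPair

variable {R : (Fin n ⊕ Fin n → ℤ) → (Fin n ⊕ Fin n → ℤ) → Prop} {jt jp : Fin n}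

/-- One move along `e_{jt} − e_{jp}`, read on the two pairs and off them. [folklore] -/
theorem exists_move_sub (hne : jt ≠ jp)
    (hC : ∀ x s, R x (transvection (stdSymp ℤ n) (Pi.single (Sum.inl jt) 1 - Pi.single (Sum.inl jp) 1, s) x))
    (x : Fin n ⊕ Fin n → ℤ) (s : Bool) :
    ∃ y, R x y ∧ y (Sum.inl jt) = x (Sum.inl jt) + sgn s * (x (Sum.inr jt) - x (Sum.inr jp)) ∧
      y (Sum.inr jt) = x (Sum.inr jt) ∧
      y (Sum.inl jp) = x (Sum.inl jp) - sgn s * (x (Sum.inr jt) - x (Sum.inr jp)) ∧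
      y (Sum.inr jp) = x (Sum.inr jp) ∧
      ∀ k, k ≠ Sum.inl jt → k ≠ Sum.inr jt → k ≠ Sum.inl jp → k ≠ Sum.inr jp → y k = x k := by
  have h1 : (Sum.inl jt : Fin n ⊕ Fin n) ≠ Sum.inl jp := fun h => hne (Sum.inl_injective h)
  refine ⟨_, hC x s, ?_, ?_, ?_, ?_, fun k hk _ hk' _ => ?_⟩ <;>
    rw [transvection_single_sub_single_apply hne]
  · rw [Function.update_of_ne h1, Function.update_self]
  · rw [Function.update_of_ne Sum.inr_ne_inl, Function.update_of_ne Sum.inr_ne_inl]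
  · rw [Function.update_self]
  · rw [Function.update_of_ne Sum.inr_ne_inl, Function.update_of_ne Sum.inr_ne_inl]
  · rw [Function.update_of_ne hk', Function.update_of_ne hk]

variable (hne : jt ≠ jp) (hrefl : ∀ x, R x x) (htrans : ∀ x y z, R x y → R y z → R x z)
  (hEt : ∀ x s, R x (transvection (stdSymp ℤ n) (Pi.single (Sum.inl jt) 1, s) x))
  (hFt : ∀ x s, R x (transvection (stdSymp ℤ n) (Pi.single (Sum.inr jt) 1, s) x))
  (hEp : ∀ x s, R x (transvection (stdSymp ℤ n) (Pi.single (Sum.inl jp) 1, s) x))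
  (hFp : ∀ x s, R x (transvection (stdSymp ℤ n) (Pi.single (Sum.inr jp) 1, s) x))
  (hC : ∀ x s, R x (transvection (stdSymp ℤ n) (Pi.single (Sum.inl jt) 1 - Pi.single (Sum.inl jp) 1, s) x))
include hne hrefl htrans hEt hFt hEp hFp hC

/-- **The two-pair kill.**  By moves along `e_{jt}, f_{jt}, e_{jp}, f_{jp}` and `e_{jt} − e_{jp}`
every vector is `R`-related to one whose `jt`-th pair vanishes, with all coordinates off the two
pairs unchanged: the Euclidean algorithm on the two gcd's `(γ, γ')` of the pairs — normalise the
pairs to `(γ, 0), (γ', γ')` resp. `(0, γ), (γ', 0)` and apply one difference move, which replaces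
`γ` by `γ − γ'` resp. `γ'` by `γ' − γ` — and, once `γ' = 0`, the explicit sequence
`(γ, γ | 0, 0) → (0, γ | γ, 0) → (0, γ | 0, γ) → (γ, 0 | 0, γ) → (0, 0 | γ, γ)`. [folklore] -/
theorem twoPair_kill (x : Fin n ⊕ Fin n → ℤ) :
    ∃ y, R x y ∧ y (Sum.inl jt) = 0 ∧ y (Sum.inr jt) = 0 ∧
      ∀ k, k ≠ Sum.inl jt → k ≠ Sum.inr jt → k ≠ Sum.inl jp → k ≠ Sum.inr jp → y k = x k := by
  have h1 : (Sum.inl jp : Fin n ⊕ Fin n) ≠ Sum.inl jt := fun h => hne (Sum.inl_injective h).symm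
  have h2 : (Sum.inr jp : Fin n ⊕ Fin n) ≠ Sum.inr jt := fun h => hne (Sum.inr_injective h).symm
  have h3 : (Sum.inl jt : Fin n ⊕ Fin n) ≠ Sum.inl jp := fun h => hne (Sum.inl_injective h)
  have h4 : (Sum.inr jt : Fin n ⊕ Fin n) ≠ Sum.inr jp := fun h => hne (Sum.inr_injective h)
  suffices H : ∀ (m : ℕ) (x : Fin n ⊕ Fin n → ℤ),
      Int.gcd (x (Sum.inl jt)) (x (Sum.inr jt)) + Int.gcd (x (Sum.inl jp)) (x (Sum.inr jp)) = m →
      ∃ y, R x y ∧ y (Sum.inl jt) = 0 ∧ y (Sum.inr jt) = 0 ∧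
        ∀ k, k ≠ Sum.inl jt → k ≠ Sum.inr jt → k ≠ Sum.inl jp → k ≠ Sum.inr jp → y k = x k from
    H _ x rfl
  intro m
  induction m using Nat.strong_induction_on with
  | _ m ih =>
  intro x hm
  set γ : ℕ := Int.gcd (x (Sum.inl jt)) (x (Sum.inr jt)) with hγ
  set γ' : ℕ := Int.gcd (x (Sum.inl jp)) (x (Sum.inr jp)) with hγ'
  rcases Nat.eq_zero_or_pos γ with h0 | hpos
  · -- the top pair already vanishes
    obtain ⟨hP, hQ⟩ := Int.gcd_eq_zero_iff.1 h0
    exact ⟨x, hrefl x, hP, hQ, fun k _ _ _ _ => rfl⟩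
  rcases Nat.eq_zero_or_pos γ' with h0' | hpos'
  · -- revive the other pair and kill: `(γ, γ | 0, 0) → (0, γ | γ, 0) → (0, γ | 0, γ) → (γ, 0 | 0, γ) → (0, 0 | γ, γ)`
    obtain ⟨hP', hQ'⟩ := Int.gcd_eq_zero_iff.1 h0'
    obtain ⟨x₁, r₁, h₁l, h₁r, h₁o⟩ := pair_euclid_diag jt hrefl htrans hEt hFt x
    obtain ⟨x₂, r₂, h₂lt, h₂rt, h₂lp, h₂rp, h₂o⟩ := exists_move_sub hne hC x₁ false
    obtain ⟨x₃, r₃, h₃l, h₃r, h₃o⟩ := pair_euclid_inr jp hrefl htrans hEp hFp x₂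
    obtain ⟨x₄, r₄, h₄l, h₄r, h₄o⟩ := pair_euclid jt hrefl htrans hEt hFt x₃
    obtain ⟨x₅, r₅, h₅lt, h₅rt, h₅lp, h₅rp, h₅o⟩ := exists_move_sub hne hC x₄ true
    -- bookkeeping of the two pairs along the way
    have e₁lp : x₁ (Sum.inl jp) = 0 := by rw [h₁o _ h1 Sum.inl_ne_inr, hP']
    have e₁rp : x₁ (Sum.inr jp) = 0 := by rw [h₁o _ Sum.inr_ne_inl h2, hQ']
    have e₂lt : x₂ (Sum.inl jt) = 0 := by rw [h₂lt, h₁l, h₁r, e₁rp, sgn_false]; ring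
    have e₂rt : x₂ (Sum.inr jt) = γ := by rw [h₂rt, h₁r]
    have e₂lp : x₂ (Sum.inl jp) = γ := by rw [h₂lp, e₁lp, h₁r, e₁rp, sgn_false]; ring
    have e₂rp : x₂ (Sum.inr jp) = 0 := by rw [h₂rp, e₁rp]
    have e₃lt : x₃ (Sum.inl jt) = 0 := by rw [h₃o _ h3 Sum.inl_ne_inr, e₂lt]
    have e₃rt : x₃ (Sum.inr jt) = γ := by rw [h₃o _ Sum.inr_ne_inl h4, e₂rt]
    have e₃rp : x₃ (Sum.inr jp) = γ := by
      rw [h₃r, e₂lp, e₂rp, Int.gcd_zero_right, Int.natAbs_natCast]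
    have e₄lt : x₄ (Sum.inl jt) = γ := by
      rw [h₄l, e₃lt, e₃rt, Int.gcd_zero_left, Int.natAbs_natCast]
    have e₄lp : x₄ (Sum.inl jp) = 0 := by rw [h₄o _ h1 Sum.inl_ne_inr, h₃l]
    have e₄rp : x₄ (Sum.inr jp) = γ := by rw [h₄o _ Sum.inr_ne_inl h2, e₃rp]
    refine ⟨x₅, htrans _ _ _ (htrans _ _ _ (htrans _ _ _ (htrans _ _ _ r₁ r₂) r₃) r₄) r₅, ?_, ?_,
      fun k hk₁ hk₂ hk₃ hk₄ => ?_⟩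
    · rw [h₅lt, e₄lt, h₄r, e₄rp, sgn_true]; ring
    · rw [h₅rt, h₄r]
    · rw [h₅o k hk₁ hk₂ hk₃ hk₄, h₄o k hk₁ hk₂, h₃o k hk₃ hk₄, h₂o k hk₁ hk₂ hk₃ hk₄, h₁o k hk₁ hk₂]
  rcases le_or_gt γ' γ with hle | hlt
  · -- reduction A: `(γ, 0 | γ', γ')`, one difference move, `γ ↦ γ − γ'`
    obtain ⟨x₁, r₁, h₁l, h₁r, h₁o⟩ := pair_euclid jt hrefl htrans hEt hFt x
    obtain ⟨x₂, r₂, h₂l, h₂r, h₂o⟩ := pair_euclid_diag jp hrefl htrans hEp hFp x₁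
    obtain ⟨x₃, r₃, h₃lt, h₃rt, h₃lp, h₃rp, h₃o⟩ := exists_move_sub hne hC x₂ true
    have e₂lp : x₂ (Sum.inl jp) = γ' := by
      rw [h₂l, h₁o _ h1 Sum.inl_ne_inr, h₁o _ Sum.inr_ne_inl h2]
    have e₂rp : x₂ (Sum.inr jp) = γ' := by
      rw [h₂r, h₁o _ h1 Sum.inl_ne_inr, h₁o _ Sum.inr_ne_inl h2]
    have e₂lt : x₂ (Sum.inl jt) = γ := by rw [h₂o _ h3 Sum.inl_ne_inr, h₁l]
    have e₂rt : x₂ (Sum.inr jt) = 0 := by rw [h₂o _ Sum.inr_ne_inl h4, h₁r]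
    have e₃lt : x₃ (Sum.inl jt) = γ - γ' := by rw [h₃lt, e₂lt, e₂rt, e₂rp, sgn_true]; ring
    have e₃rt : x₃ (Sum.inr jt) = 0 := by rw [h₃rt, e₂rt]
    have e₃lp : x₃ (Sum.inl jp) = γ' + 1 * γ' := by rw [h₃lp, e₂lp, e₂rt, e₂rp, sgn_true]; ring
    have e₃rp : x₃ (Sum.inr jp) = γ' := by rw [h₃rp, e₂rp]
    have hm₃ : Int.gcd (x₃ (Sum.inl jt)) (x₃ (Sum.inr jt)) + Int.gcd (x₃ (Sum.inl jp)) (x₃ (Sum.inr jp)) < m := by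
      rw [e₃lt, e₃rt, e₃lp, e₃rp, Int.gcd_zero_right, Int.gcd_add_mul_right_left, Int.gcd_self,
        Int.natAbs_natCast, ← hm]
      omega
    obtain ⟨y, ry, hyl, hyr, hyo⟩ := ih _ hm₃ x₃ rfl
    refine ⟨y, htrans _ _ _ (htrans _ _ _ (htrans _ _ _ r₁ r₂) r₃) ry, hyl, hyr, fun k hk₁ hk₂ hk₃ hk₄ => ?_⟩
    rw [hyo k hk₁ hk₂ hk₃ hk₄, h₃o k hk₁ hk₂ hk₃ hk₄, h₂o k hk₃ hk₄, h₁o k hk₁ hk₂]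
  · -- reduction B: `(0, γ | γ', 0)`, one difference move, `γ' ↦ γ' − γ`
    obtain ⟨x₁, r₁, h₁l, h₁r, h₁o⟩ := pair_euclid_inr jt hrefl htrans hEt hFt x
    obtain ⟨x₂, r₂, h₂l, h₂r, h₂o⟩ := pair_euclid jp hrefl htrans hEp hFp x₁
    obtain ⟨x₃, r₃, h₃lt, h₃rt, h₃lp, h₃rp, h₃o⟩ := exists_move_sub hne hC x₂ true
    have e₂lp : x₂ (Sum.inl jp) = γ' := by
      rw [h₂l, h₁o _ h1 Sum.inl_ne_inr, h₁o _ Sum.inr_ne_inl h2]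
    have e₂rp : x₂ (Sum.inr jp) = 0 := h₂r
    have e₂lt : x₂ (Sum.inl jt) = 0 := by rw [h₂o _ h3 Sum.inl_ne_inr, h₁l]
    have e₂rt : x₂ (Sum.inr jt) = γ := by rw [h₂o _ Sum.inr_ne_inl h4, h₁r]
    have e₃lt : x₃ (Sum.inl jt) = γ + 0 * γ := by rw [h₃lt, e₂lt, e₂rt, e₂rp, sgn_true]; ring
    have e₃rt : x₃ (Sum.inr jt) = γ := by rw [h₃rt, e₂rt]
    have e₃lp : x₃ (Sum.inl jp) = γ' - γ := by rw [h₃lp, e₂lp, e₂rt, e₂rp, sgn_true]; ring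
    have e₃rp : x₃ (Sum.inr jp) = 0 := by rw [h₃rp, e₂rp]
    have hm₃ : Int.gcd (x₃ (Sum.inl jt)) (x₃ (Sum.inr jt)) + Int.gcd (x₃ (Sum.inl jp)) (x₃ (Sum.inr jp)) < m := by
      rw [e₃lt, e₃rt, e₃lp, e₃rp, Int.gcd_zero_right, Int.gcd_add_mul_right_left, Int.gcd_self,
        Int.natAbs_natCast, ← hm]
      omega
    obtain ⟨y, ry, hyl, hyr, hyo⟩ := ih _ hm₃ x₃ rfl
    refine ⟨y, htrans _ _ _ (htrans _ _ _ (htrans _ _ _ r₁ r₂) r₃) ry, hyl, hyr, fun k hk₁ hk₂ hk₃ hk₄ => ?_⟩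
    rw [hyo k hk₁ hk₂ hk₃ hk₄, h₃o k hk₁ hk₂ hk₃ hk₄, h₂o k hk₃ hk₄, h₁o k hk₁ hk₂]

end TwoPair

/-! ## The registered form -/

/-- **Sub-goal `helper_twoPair_transvection_kill`** (G6-1, algebra of node N3a `node_STcurve`):
for any reflexive–transitive relation on `ℤ^{Fin n ⊕ Fin n}` closed under the transvections
(`SignedHurwitzAction.transvection` for `stdSymp ℤ n`, both signs) along `e_{jt}, f_{jt}, e_{jp},
f_{jp}` and `e_{jt} − e_{jp}` (`jt ≠ jp`), every vector is related to one whose `jt`-th symplectic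
pair vanishes and whose coordinates off the two pairs are unchanged. [folklore] -/
theorem helper_twoPair_transvection_kill : ∀ (n : ℕ) (jt jp : Fin n) (R : (Fin n ⊕ Fin n → ℤ) → (Fin n ⊕ Fin n → ℤ) → Prop), jt ≠ jp → (∀ x, R x x) → (∀ x y z, R x y → R y z → R x z) → (∀ x s, R x (Literature.GroupTheory.CombinatorialGroupTheory.SignedHurwitz.transvection (Literature.GroupTheory.CombinatorialGroupTheory.SignedHurwitz.stdSymp ℤ n) (Pi.single (Sum.inl jt) 1, s) x)) → (∀ x s, R x (Literature.GroupTheory.CombinatorialGroupTheory.SignedHurwitz.transvection (Literature.GroupTheory.CombinatorialGroupTheory.SignedHurwitz.stdSymp ℤ n) (Pi.single (Sum.inr jt) 1, s) x)) → (∀ x s, R x (Literature.GroupTheory.CombinatorialGroupTheory.SignedHurwitz.transvection (Literature.GroupTheory.CombinatorialGroupTheory.SignedHurwitz.stdSymp ℤ n) (Pi.single (Sum.inl jp) 1, s) x)) → (∀ x s, R x (Literature.GroupTheory.CombinatorialGroupTheory.SignedHurwitz.transvection (Literature.GroupTheory.CombinatorialGroupTheory.SignedHurwitz.stdSymp ℤ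 n) (Pi.single (Sum.inr jp) 1, s) x)) → (∀ x s, R x (Literature.GroupTheory.CombinatorialGroupTheory.SignedHurwitz.transvection (Literature.GroupTheory.CombinatorialGroupTheory.SignedHurwitz.stdSymp ℤ n) (Pi.single (Sum.inl jt) 1 - Pi.single (Sum.inl jp) 1, s) x)) → ∀ x, ∃ y, R x y ∧ y (Sum.inl jt) = 0 ∧ y (Sum.inr jt) = 0 ∧ ∀ k, k ≠ Sum.inl jt → k ≠ Sum.inr jt → k ≠ Sum.inl jp → k ≠ Sum.inr jp → y k = x k :=
  fun _ _ _ _ hne hrefl htrans hEt hFt hEp hFp hC x =>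
    twoPair_kill hne hrefl htrans hEt hFt hEp hFp hC x

end Summit.SmoothPoincare4.SmoothPoincare4.Theorems.AcyclicBisectionExists.ModpBraidOrbits

end
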